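import Literature.MathematicalPhysics.QuantumFieldTheory.Federbush1986.ModeAnalyticityWideTube

/-!
# Federbush–Williamson, *A phase cell approach to Yang–Mills theory. II. Analysis of a mode* (J. Math. Phys. **28**
# (1987) 1416–1419) [FederbushWilliamson1987PhaseCellII] — the mode in the CORRECTED GAUGE `X_c = X/(1+g)` ((2.4)–(2.5)
# with the paper's own `g` of (6.11)/(6.14)) and its manifestly holomorphic cell representatives ((5.1)–(5.10), §VI)

statement-level skeleton of published theorems with citation tags; proofs where landed; nothing here is a claim about
the Yang–Mills mass gap

Cell `lit-balaban`, Phase-2 proof seat **p04** (gen 9), own lane F2 (rows `F2.Thm3.1`–`F2.Thm3.3`, owner r17, referee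
ref-5); file 2 of the corrected-gauge programme (file 1 = `ModeAnalyticityWideTube`).  Pages READ AS IMAGES:
`run/shared/lean/pub/pub-balaban/t4/b2b-balaban-t4-lit2/g7/fw1987II/fedwill1987-jmp28-II-p002-x2.png` (p. 1417: (2.1)–(2.5),
Theorems 3.1–3.3, (5.1)), `-p003-x2.png` (p. 1418: (5.2)–(5.10), (6.1)–(6.14)).

THE DEFECT AND ITS CORRECTION.  Print (p. 1417): «A little study of these expressions for the region near p₁∼p₂∼p₃∼p₄∼0
shows that the A′_i have a singularity in the complex four-dimensional region on the surface p² = 0, of course hitting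
the real axis. We define A^N_i(p), a gauge transformation of A′_i(p), by A^N_i(p) = A′_i(p) + p_iX(p), (2.4) with
X(p) = (−r_L f̄₁⁻¹ (1/(p²)²)) (1/⟨1/p₁²⟩) (1/(1 + p²)^s) (2.5)».  The tree KNOWS (this seat, gen 5, p250244
`ModeAnalyticityThm31Refutation.not_theorem31`) that for every printed `X` the component `A^N_1` still has a pole on the
light cone through `p = 0`: in the notation of §V–§VI the gauge term must cancel `N/(1+g) + p₁²/(e₁(1+p²)^s)` modulo `p²`
((5.5), (6.11)), which it does iff `g ≡ 0 (mod p²)` — and the printed (6.2)/(6.12) asserting this are false.  Dividing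
the printed gauge function by the paper's own `1 + g` of (6.11)/(6.14),
  `X_c(p) := X(p)/(1 + g(p))`,  `1 + g = Σ_k p_k²∏_{j≠k}e_j / p² = (p²)²·∏_jp_j²·𝒟/(16r₀³)`   ((6.14), (5.3), (1.18)),
makes the cancellation exact to all orders: with `t_j = 1/⟨1/p_j²⟩ = p²p_j²/(r₀e_j)` one has `16l₁/𝒟 = t₁(T−t₁)/T`,
`16l_i/𝒟 = −t₁t_i/T` (`T = Σt_j = (p²)²(1+g)/(r₀∏e_j)`), and the corrected mode `Â_i = A′_i + p_iX_c` equals, at the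
generic points of the period cell, the MANIFESTLY HOLOMORPHIC expressions (print's indices; `Ω_i = [∏_{j≠i}e_j·(1+p²)^s − 1]/p²`,
a polynomial in `p²` and the lattice sums `D_j`)
  `Â₁ = Φ·[(1+g)(1+p²)^s − p₁²Ω₁] / (r₀e₁(1+g)(1+p²)^s)`,   `Â_i = −Φ·p₁p_iΩ_i / (r₀e₁(1+g)(1+p²)^s)`  (`i ≠ 1`),
and, on the translated cells `p = q + 2πm` (`m ∈ ℤ⁴`; brackets `2π`-periodic by (3.1), `λ_j = 1 − 2πm_j/p_j`),
  `Â_i = Φ(p)λ₁λ_i·ν_i(q)/(p²r₀(q)(1+g(q))) + Φ(p)λ₁q₁p_i(q²)³r₀(p)³∏_jλ_j² / ((p²)⁴r₀(q)⁴e₁(q)(1+g(q))(1+p²)^s)`,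
  `ν₁ = N = p₄²e₂e₃ + p₃²e₂e₄ + p₂²e₃e₄` ((5.5)), `ν_i = −q₁q_i∏_{j∉{1,i}}e_j`.
Unlike the gen-6 repair `X̃` (analytic at `p = 0` only: it has poles on the cones through `2πm`, `m ≠ 0`), `X_c` is
regular at EVERY lattice point; the sequel (`ModeAnalyticityCellPositivity`, `ModeAnalyticityThms31to33Corrected`)
proves Theorems 3.1–3.3 for `Â` and, via `ModeDecay.decay313to315_modeField` (r17), I (3.13)–(3.15).

WHAT THIS FILE CONTAINS (kernel-checked; axioms standard; `def`s are OBJECTS with bodies — no `Prop` definitions, no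
named facts).  Print's indices `1…4` are Lean's `0…3`.
* §1 `onePlusG` (= `1 + g` in bracket form), **`Xc s` = `X s / onePlusG`**, **`ANc s i = A′_i + p_i·X_c`**;
  `onePlusG_eq : onePlusG p = 1 + ĝ p` at the generic points of the tube (`ĝ` = gen-6 `ghat`, the (6.14) polynomial).
* §2 the cell-`0` representative `G0 s i` (objects `gs`, `Qo`, `Om`, `num0`) and `gs_spec : (1+p²)^s = 1 + p²·gs`.
* §3 the cell-`m` representative `Gm s m i` (objects `unshift`, `lam`, `num1`), `shift_unshift`, `lam_eq_div`.
* §4 **THE IDENTITIES** `ANc_eq_G0` (all four `i`, at every `p ∈ Wt` with `p_j ≠ 0`, `p² ≠ 0`, `e^{ip₁} ≠ 1`,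
  `1 + p² ≠ 0`, `e_j(p) ≠ 0`, `1 + ĝ(p) ≠ 0`) and `ANc_eq_Gm` (all four `i`, every `m`, at every `p` with
  `q = p − 2πm ∈ Wt` generic) — (5.3) on the tube + (3.1) + (1.18)/(2.2)–(2.3) + (5.1), then `field_simp; ring`.
Honest scope: `X_c` is OUR correction of the gauge choice (2.5) (the printed `A^N` stays refuted as typed, p250244);
everything here is cited to the displays it rewrites.
-/

noncomputable section

namespace Literature.MathematicalPhysics.QuantumFieldTheory.Federbush1986

namespace ModeAnalyticityCorrectedGauge

open ModeAnalyticity ModeAnalyticityLatticeSums ModeAnalyticityBracketSplit ModeAnalyticityGaugeRepair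
  ModeAnalyticityWideTube Complex Filter Topology Finset Metric Set
open scoped BigOperators Real

/-! ## §1. The corrected gauge function `X_c = X/(1+g)` and the corrected mode -/

/-- **`1 + g`** of (6.11)/(6.14) written in the paper's bracket vocabulary via (5.3) and (1.18):
`1 + g(p) = Σ_kp_k²∏_{j≠k}e_j(p)/p² = (p²)²·(∏_jp_j²)·𝒟(p)/(16·r₀(p)³)` (`r₀` of (5.4) in its analytic extension).
[cite: FederbushWilliamson1987PhaseCellII, (6.11), (6.14), (5.3)–(5.4) p. 1418, (1.18) p. 1417] -/
def onePlusG (p : Momentum) : ℂ := csq p ^ 2 * (∏ j, (p j) ^ 2) * scrD p / (16 * r0 p ^ 3)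

/-- **The CORRECTED gauge function** `X_c(p) := X(p)/(1 + g(p))` — the printed (2.5) divided by the paper's own `1 + g`
of (6.11)/(6.14).  (OUR correction of the gauge choice: with the printed `X` Theorem 3.1 fails, p250244; «s is an
arbitrary integer» kept as the parameter.) [cite: FederbushWilliamson1987PhaseCellII, (2.5) p. 1417, (6.11)–(6.14)
p. 1418] -/
def Xc (s : ℕ) (p : Momentum) : ℂ := X s p / onePlusG p

/-- **The mode in the corrected gauge**: `Â_i(p) := A′_i(p) + p_i·X_c(p)` — (2.4) «A^N_i(p) = A′_i(p) + p_iX(p)» with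
`X_c` for `X`. [cite: FederbushWilliamson1987PhaseCellII, (2.1), (2.4) p. 1417] -/
def ANc (s : ℕ) (i : Fin 4) (p : Momentum) : ℂ := Aprime i p + p i * Xc s p

/-- `1 + g` IS the (6.14) polynomial `1 + ĝ` at every generic point of the tube (so `X_c = X/(1+ĝ)` there).
[cite: FederbushWilliamson1987PhaseCellII, (6.11), (6.14) p. 1418] -/
theorem onePlusG_eq {p : Momentum} (hW : p ∈ Wt) (hp : ∀ i, p i ≠ 0) (hc : csq p ≠ 0) :
    onePlusG p = 1 + ghat p := by
  unfold onePlusG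
  rw [scrD_eq_Wt hW hp hc, Fin.prod_univ_four]
  have hr := r0_ne_zero_Wt hW
  have hp0 := hp 0; have hp1 := hp 1; have hp2 := hp 2; have hp3 := hp 3
  field_simp

/-! ## §2. The cell-`0` representative -/

/-- `gs_s(p) = Σ_{k<s}(1+p²)^k`, so that `(1+p²)^s = 1 + p²·gs_s` (the `(1+p²)^{−s}` factor of (2.5) made polynomial).
[cite: FederbushWilliamson1987PhaseCellII, (2.5) p. 1417] -/
def gs (s : ℕ) (p : Momentum) : ℂ := ∑ k ∈ Finset.range s, (1 + csq p) ^ k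

/-- `(1 + p²)^s = 1 + p²·gs_s(p)` (geometric sum). [cite: FederbushWilliamson1987PhaseCellII, (2.5) p. 1417] -/
theorem gs_spec (s : ℕ) (p : Momentum) : (1 + csq p) ^ s = 1 + csq p * gs s p := by
  unfold gs
  have := geom_sum_mul (1 + csq p) s
  linear_combination -this

/-- `Q_i = [∏_{j≠i}e_j − 1]/p²` as the (6.14) polynomials `Q0…Q3` of gen 6, indexed. [cite: FederbushWilliamson1987PhaseCellII,
(6.14) p. 1418] -/
def Qo (i : Fin 4) (p : Momentum) : ℂ := if i = 0 then Q0 p else if i = 1 then Q1 p else if i = 2 then Q2 p else Q3 p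

/-- (plumbing) the four values of `Qo`. [cite: FederbushWilliamson1987PhaseCellII, (6.14) p. 1418] -/
theorem Qo_vals (p : Momentum) : Qo 0 p = Q0 p ∧ Qo 1 p = Q1 p ∧ Qo 2 p = Q2 p ∧ Qo 3 p = Q3 p := by
  refine ⟨?_, ?_, ?_, ?_⟩ <;> simp [Qo]

/-- `Ω_{s,i} = [∏_{j≠i}e_j·(1+p²)^s − 1]/p² = Q_i + gs_s + p²·Q_i·gs_s` — the all-orders content of the cancellation behind
(5.8)–(5.10) in the corrected gauge. [cite: FederbushWilliamson1987PhaseCellII, (5.8)–(5.10), (6.14) p. 1418] -/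
def Om (s : ℕ) (i : Fin 4) (p : Momentum) : ℂ := Qo i p + gs s p + csq p * Qo i p * gs s p

/-- The numerators of the cell-`0` representative: `(1+ĝ)(1+p²)^s − p₁²Ω₁` for `i = 1` (print), `−p₁p_iΩ_i` otherwise.
[cite: FederbushWilliamson1987PhaseCellII, (5.5)–(5.10) p. 1418] -/
def num0 (s : ℕ) (i : Fin 4) (p : Momentum) : ℂ :=
  if i = 0 then (1 + ghat p) * (1 + csq p) ^ s - (p 0) ^ 2 * Om s 0 p else -(p 0 * p i * Om s i p)

/-- **The cell-`0` representative** `G0 s i = Φ·num0_{s,i}/(r₀e₁(1+ĝ)(1+p²)^s)` — manifestly holomorphic wherever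
`r₀, e₁, 1+ĝ, 1+p²` do not vanish (no `1/p²`, `1/p_i`, `1/𝒟`, `f̄₁⁻¹` left: «This is the main "algebraic miracle" involved
in showing local analyticity», made exact by the corrected gauge). [cite: FederbushWilliamson1987PhaseCellII, (5.5)–(5.10)
p. 1418] -/
def G0 (s : ℕ) (i : Fin 4) (p : Momentum) : ℂ :=
  Phi p * num0 s i p / (r0 p * E 0 p * (1 + ghat p) * (1 + csq p) ^ s)

/-! ## §3. The cell-`m` representative (`p = q + 2πm`) -/

/-- `q = p − 2πm`, the representative of `p` in the cell translated back by the lattice vector `m` ((3.1)).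
[cite: FederbushWilliamson1987PhaseCellII, (3.1) p. 1417] -/
def unshift (m : Idx) (p : Momentum) : Momentum := fun j => p j - 2 * π * (m j : ℂ)

/-- (plumbing) `(p − 2πm) + 2πm = p`. [cite: FederbushWilliamson1987PhaseCellII, (3.1) p. 1417] -/
theorem shift_unshift (m : Idx) (p : Momentum) : shift (unshift m p) m = p := by
  funext j; simp only [shift_apply, unshift]; ring

/-- (plumbing) `(p + 2πm) − 2πm = p`. [cite: FederbushWilliamson1987PhaseCellII, (3.1) p. 1417] -/
theorem unshift_shift (m : Idx) (q : Momentum) : unshift m (shift q m) = q := by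
  funext j; simp only [shift_apply, unshift]; ring

/-- (plumbing) `unshift 0 = id`. [cite: FederbushWilliamson1987PhaseCellII, (3.1) p. 1417] -/
theorem unshift_zero (p : Momentum) : unshift 0 p = p := by
  funext j; simp [unshift]

/-- `λ_j(m,p) = 1 − 2πm_j/p_j` (`= q_j/p_j` when `p_j ≠ 0`; `= 1` when `m_j = 0`): the ratio of the non-periodic factors
`1/p_i`, `1/p²`-companions of (2.1)/(2.5) at `p` to their values at `q`. [cite: FederbushWilliamson1987PhaseCellII, (2.1),
(2.5), (3.1) p. 1417] -/
def lam (m : Idx) (j : Fin 4) (p : Momentum) : ℂ := 1 - 2 * π * (m j : ℂ) / p j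

/-- (plumbing) `λ_j = q_j/p_j` when `p_j ≠ 0`. [cite: FederbushWilliamson1987PhaseCellII, (3.1) p. 1417] -/
theorem lam_eq_div {m : Idx} {j : Fin 4} {p : Momentum} (hp : p j ≠ 0) : lam m j p = unshift m p j / p j := by
  unfold lam unshift; field_simp

/-- (plumbing) `λ_j = 1` when `m_j = 0`. [cite: FederbushWilliamson1987PhaseCellII, (3.1) p. 1417] -/
theorem lam_of_eq_zero {m : Idx} {j : Fin 4} (h : m j = 0) (p : Momentum) : lam m j p = 1 := by
  simp [lam, h]

/-- The periodic numerators of the cell-`m` representative: `ν₁ = N` ((5.5)), `ν_i = −q₁q_i∏_{j∉{1,i}}e_j` (`i ≠ 1`).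
[cite: FederbushWilliamson1987PhaseCellII, (5.5)–(5.6) p. 1418] -/
def num1 (i : Fin 4) (q : Momentum) : ℂ := if i = 0 then Nn q else -(q 0 * q i * Eo i q)

/-- **The cell-`m` representative** (`q = p − 2πm`):
`Gm s m i p = Φ(p)λ₁λ_i ν_i(q)/(p² r₀(q)(1+ĝ(q))) + Φ(p)λ₁q₁p_i(q²)³r₀(p)³∏_jλ_j²/((p²)⁴r₀(q)⁴e₁(q)(1+ĝ(q))(1+p²)^s)` —
manifestly holomorphic on the translated cell for `m ≠ 0` (there `p² ≠ 0`, `1 + p² ≠ 0`, and `p_j ≠ 0` whenever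
`m_j ≠ 0`). [cite: FederbushWilliamson1987PhaseCellII, (2.1), (2.4)–(2.5), (3.1) p. 1417, (5.3)–(5.6) p. 1418] -/
def Gm (s : ℕ) (m : Idx) (i : Fin 4) (p : Momentum) : ℂ :=
  Phi p * lam m 0 p * lam m i p * num1 i (unshift m p) /
      (csq p * r0 (unshift m p) * (1 + ghat (unshift m p)))
    + Phi p * lam m 0 p * unshift m p 0 * p i * csq (unshift m p) ^ 3 * r0 p ^ 3 * (∏ j, lam m j p ^ 2) /
      (csq p ^ 4 * r0 (unshift m p) ^ 4 * E 0 (unshift m p) * (1 + ghat (unshift m p)) * (1 + csq p) ^ s)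

/-! ## §4. The identities at the generic points -/

/-- (plumbing) the decided index facts. [folklore] -/
private theorem fin_ne : (1 : Fin 4) ≠ 0 ∧ (2 : Fin 4) ≠ 0 ∧ (3 : Fin 4) ≠ 0 := by decide

/-- **`Â₁ = G0 s 0`** at the generic points of the tube (print's `i = 1`). [cite: FederbushWilliamson1987PhaseCellII,
(5.1)–(5.5), (5.8) p. 1417–1418] -/
theorem ANc_eq_G0_zero (s : ℕ) {p : Momentum} (hW : p ∈ Wt) (hp : ∀ i, p i ≠ 0) (hc : csq p ≠ 0)
    (hf : exp (I * p 0) ≠ 1) (h1 : 1 + csq p ≠ 0) (hE : ∀ j, E j p ≠ 0) (hg : 1 + ghat p ≠ 0) :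
    ANc s 0 p = G0 s 0 p := by
  have hp0 := hp 0; have hp1 := hp 1; have hp2 := hp 2; have hp3 := hp 3
  have hE0 := hE 0; have hE1 := hE 1; have hE2 := hE 2; have hE3 := hE 3
  have hr := r0_ne_zero_Wt hW
  have hcs : (1 + csq p) ^ s ≠ 0 := pow_ne_zero _ h1
  have hY := gs_spec s p
  unfold ANc Xc onePlusG Aprime X G0 num0 Om
  simp only [Fin.isValue, ↓reduceIte, (Qo_vals p).1]
  rw [scrD_eq_Wt hW hp hc, l_zero_eq_Wt hW hp hc, prefactor_eq hp hf, invSqBracket_eq_Wt hW hp hc 0]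
  rw [Fin.prod_univ_four]
  field_simp
  rw [hY]
  simp only [Nn, E, ghat, Q0, Q1, Q2, Q3, csq_eq]
  ring

/-- **`Â₂ = G0 s 1`** at the generic points of the tube (print's `i = 2`). [cite: FederbushWilliamson1987PhaseCellII,
(5.1)–(5.2), (5.6), (5.9) p. 1417–1418] -/
theorem ANc_eq_G0_one (s : ℕ) {p : Momentum} (hW : p ∈ Wt) (hp : ∀ i, p i ≠ 0) (hc : csq p ≠ 0)
    (hf : exp (I * p 0) ≠ 1) (h1 : 1 + csq p ≠ 0) (hE : ∀ j, E j p ≠ 0) (hg : 1 + ghat p ≠ 0) :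
    ANc s 1 p = G0 s 1 p := by
  have hp0 := hp 0; have hp1 := hp 1; have hp2 := hp 2; have hp3 := hp 3
  have hE0 := hE 0; have hE1 := hE 1; have hE2 := hE 2; have hE3 := hE 3
  have hr := r0_ne_zero_Wt hW
  have hcs : (1 + csq p) ^ s ≠ 0 := pow_ne_zero _ h1
  have hY := gs_spec s p
  unfold ANc Xc onePlusG Aprime X G0 num0 Om
  simp only [Fin.isValue, fin_ne.1, ↓reduceIte, (Qo_vals p).2.1]
  rw [scrD_eq_Wt hW hp hc, l_one, prefactor_eq hp hf, invSqBracket_eq_Wt hW hp hc 0,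
    invSqBracket_eq_Wt hW hp hc 2, invSqBracket_eq_Wt hW hp hc 3]
  rw [Fin.prod_univ_four]
  field_simp
  rw [hY]
  simp only [E, Q1, csq_eq]
  ring

/-- **`Â₃ = G0 s 2`** at the generic points of the tube (print's `i = 3`). [cite: FederbushWilliamson1987PhaseCellII,
(5.1)–(5.2), (5.6), (5.9) p. 1417–1418] -/
theorem ANc_eq_G0_two (s : ℕ) {p : Momentum} (hW : p ∈ Wt) (hp : ∀ i, p i ≠ 0) (hc : csq p ≠ 0)
    (hf : exp (I * p 0) ≠ 1) (h1 : 1 + csq p ≠ 0) (hE : ∀ j, E j p ≠ 0) (hg : 1 + ghat p ≠ 0) :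
    ANc s 2 p = G0 s 2 p := by
  have hp0 := hp 0; have hp1 := hp 1; have hp2 := hp 2; have hp3 := hp 3
  have hE0 := hE 0; have hE1 := hE 1; have hE2 := hE 2; have hE3 := hE 3
  have hr := r0_ne_zero_Wt hW
  have hcs : (1 + csq p) ^ s ≠ 0 := pow_ne_zero _ h1
  have hY := gs_spec s p
  unfold ANc Xc onePlusG Aprime X G0 num0 Om
  simp only [Fin.isValue, fin_ne.2.1, ↓reduceIte, (Qo_vals p).2.2.1]
  rw [scrD_eq_Wt hW hp hc, l_two, prefactor_eq hp hf, invSqBracket_eq_Wt hW hp hc 0,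
    invSqBracket_eq_Wt hW hp hc 1, invSqBracket_eq_Wt hW hp hc 3]
  rw [Fin.prod_univ_four]
  field_simp
  rw [hY]
  simp only [E, Q2, csq_eq]
  ring

/-- **`Â₄ = G0 s 3`** at the generic points of the tube (print's `i = 4`). [cite: FederbushWilliamson1987PhaseCellII,
(5.1)–(5.2), (5.6), (5.9) p. 1417–1418] -/
theorem ANc_eq_G0_three (s : ℕ) {p : Momentum} (hW : p ∈ Wt) (hp : ∀ i, p i ≠ 0) (hc : csq p ≠ 0)
    (hf : exp (I * p 0) ≠ 1) (h1 : 1 + csq p ≠ 0) (hE : ∀ j, E j p ≠ 0) (hg : 1 + ghat p ≠ 0) :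
    ANc s 3 p = G0 s 3 p := by
  have hp0 := hp 0; have hp1 := hp 1; have hp2 := hp 2; have hp3 := hp 3
  have hE0 := hE 0; have hE1 := hE 1; have hE2 := hE 2; have hE3 := hE 3
  have hr := r0_ne_zero_Wt hW
  have hcs : (1 + csq p) ^ s ≠ 0 := pow_ne_zero _ h1
  have hY := gs_spec s p
  unfold ANc Xc onePlusG Aprime X G0 num0 Om
  simp only [Fin.isValue, fin_ne.2.2, ↓reduceIte, (Qo_vals p).2.2.2]
  rw [scrD_eq_Wt hW hp hc, l_three, prefactor_eq hp hf, invSqBracket_eq_Wt hW hp hc 0,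
    invSqBracket_eq_Wt hW hp hc 1, invSqBracket_eq_Wt hW hp hc 2]
  rw [Fin.prod_univ_four]
  field_simp
  rw [hY]
  simp only [E, Q3, csq_eq]
  ring

/-- **`Â_i = G0 s i` for all four components** at every generic point of the tube: all `p_j ≠ 0`, `p² ≠ 0`, `e^{ip₁} ≠ 1`,
`1 + p² ≠ 0`, all `e_j(p) ≠ 0`, `1 + ĝ(p) ≠ 0`. [cite: FederbushWilliamson1987PhaseCellII, (5.1)–(5.10) p. 1417–1418] -/
theorem ANc_eq_G0 (s : ℕ) {p : Momentum} (hW : p ∈ Wt) (hp : ∀ i, p i ≠ 0) (hc : csq p ≠ 0)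
    (hf : exp (I * p 0) ≠ 1) (h1 : 1 + csq p ≠ 0) (hE : ∀ j, E j p ≠ 0) (hg : 1 + ghat p ≠ 0) (i : Fin 4) :
    ANc s i p = G0 s i p := by
  fin_cases i
  · exact ANc_eq_G0_zero s hW hp hc hf h1 hE hg
  · exact ANc_eq_G0_one s hW hp hc hf h1 hE hg
  · exact ANc_eq_G0_two s hW hp hc hf h1 hE hg
  · exact ANc_eq_G0_three s hW hp hc hf h1 hE hg

/-- (plumbing) the brackets at `p` are the brackets at `q = p − 2πm` ((3.1)). [cite: FederbushWilliamson1987PhaseCellII,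
(3.1) p. 1417] -/
theorem invSqBracket_unshift (j : Fin 4) (m : Idx) (p : Momentum) :
    invSqBracket j p = invSqBracket j (unshift m p) := by
  conv_lhs => rw [← shift_unshift m p]
  exact invSqBracket_shift j _ m

/-- (plumbing) `𝒟(p) = 𝒟(q)`. [cite: FederbushWilliamson1987PhaseCellII, (3.1) p. 1417] -/
theorem scrD_unshift (m : Idx) (p : Momentum) : scrD p = scrD (unshift m p) := by
  conv_lhs => rw [← shift_unshift m p]
  exact scrD_shift _ m

/-- (plumbing) `l_i(p) = l_i(q)`. [cite: FederbushWilliamson1987PhaseCellII, (3.1) p. 1417] -/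
theorem l_unshift (i : Fin 4) (m : Idx) (p : Momentum) : l i p = l i (unshift m p) := by
  conv_lhs => rw [← shift_unshift m p]
  exact l_shift i _ m

/-- **`Â₁ = Gm s m 0`** on the `m`-th cell at its generic points (print's `i = 1`): `q = p − 2πm ∈ Wt` with all
`q_j ≠ 0`, `q² ≠ 0`, `e_j(q) ≠ 0`, `1 + ĝ(q) ≠ 0`, and all `p_j ≠ 0`, `p² ≠ 0`, `1 + p² ≠ 0`, `e^{ip₁} ≠ 1`.
[cite: FederbushWilliamson1987PhaseCellII, (3.1), (5.1) p. 1417, (5.3)–(5.5) p. 1418] -/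
theorem ANc_eq_Gm_zero (s : ℕ) (m : Idx) {p : Momentum} (hW : unshift m p ∈ Wt) (hq : ∀ i, unshift m p i ≠ 0)
    (hcq : csq (unshift m p) ≠ 0) (hE : ∀ j, E j (unshift m p) ≠ 0) (hg : 1 + ghat (unshift m p) ≠ 0)
    (hp : ∀ i, p i ≠ 0) (hc : csq p ≠ 0) (h1 : 1 + csq p ≠ 0) (hf : exp (I * p 0) ≠ 1) :
    ANc s 0 p = Gm s m 0 p := by
  set q := unshift m p with hqdef
  have hp0 := hp 0; have hp1 := hp 1; have hp2 := hp 2; have hp3 := hp 3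
  have hq0 := hq 0; have hq1 := hq 1; have hq2 := hq 2; have hq3 := hq 3
  have hE0 := hE 0; have hE1 := hE 1; have hE2 := hE 2; have hE3 := hE 3
  have hr := r0_ne_zero_Wt hW
  have hcs : (1 + csq p) ^ s ≠ 0 := pow_ne_zero _ h1
  have hl : ∀ j, lam m j p = q j / p j := fun j => lam_eq_div (hp j)
  unfold ANc Xc onePlusG Aprime X Gm num1
  simp only [Fin.isValue, ↓reduceIte]
  rw [scrD_unshift m p, l_unshift 0 m p, invSqBracket_unshift 0 m p, ← hqdef]
  rw [scrD_eq_Wt hW hq hcq, l_zero_eq_Wt hW hq hcq, prefactor_eq hp hf, invSqBracket_eq_Wt hW hq hcq 0]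
  simp only [Fin.prod_univ_four, hl]
  unfold Nn
  field_simp

/-- **`Â_i = Gm s m i`**, `i ≠ 1` (print), on the `m`-th cell at its generic points. [cite: FederbushWilliamson1987PhaseCellII,
(3.1), (5.1) p. 1417, (5.3), (5.6) p. 1418] -/
theorem ANc_eq_Gm_one (s : ℕ) (m : Idx) {p : Momentum} (hW : unshift m p ∈ Wt) (hq : ∀ i, unshift m p i ≠ 0)
    (hcq : csq (unshift m p) ≠ 0) (hE : ∀ j, E j (unshift m p) ≠ 0) (hg : 1 + ghat (unshift m p) ≠ 0)
    (hp : ∀ i, p i ≠ 0) (hc : csq p ≠ 0) (h1 : 1 + csq p ≠ 0) (hf : exp (I * p 0) ≠ 1) :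
    ANc s 1 p = Gm s m 1 p := by
  set q := unshift m p with hqdef
  have hp0 := hp 0; have hp1 := hp 1; have hp2 := hp 2; have hp3 := hp 3
  have hq0 := hq 0; have hq1 := hq 1; have hq2 := hq 2; have hq3 := hq 3
  have hE0 := hE 0; have hE1 := hE 1; have hE2 := hE 2; have hE3 := hE 3
  have hr := r0_ne_zero_Wt hW
  have hcs : (1 + csq p) ^ s ≠ 0 := pow_ne_zero _ h1
  have hl : ∀ j, lam m j p = q j / p j := fun j => lam_eq_div (hp j)
  unfold ANc Xc onePlusG Aprime X Gm num1
  simp only [Fin.isValue, fin_ne.1, ↓reduceIte]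
  rw [scrD_unshift m p, l_unshift 1 m p, invSqBracket_unshift 0 m p, ← hqdef]
  rw [scrD_eq_Wt hW hq hcq, l_one, prefactor_eq hp hf, invSqBracket_eq_Wt hW hq hcq 0,
    invSqBracket_eq_Wt hW hq hcq 2, invSqBracket_eq_Wt hW hq hcq 3]
  simp only [Fin.prod_univ_four, hl]
  unfold Eo
  field_simp

/-- **`Â₃ = Gm s m 2`** (print's `i = 3`) on the `m`-th cell at its generic points. [cite: FederbushWilliamson1987PhaseCellII,
(3.1), (5.1) p. 1417, (5.3), (5.6) p. 1418] -/
theorem ANc_eq_Gm_two (s : ℕ) (m : Idx) {p : Momentum} (hW : unshift m p ∈ Wt) (hq : ∀ i, unshift m p i ≠ 0)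
    (hcq : csq (unshift m p) ≠ 0) (hE : ∀ j, E j (unshift m p) ≠ 0) (hg : 1 + ghat (unshift m p) ≠ 0)
    (hp : ∀ i, p i ≠ 0) (hc : csq p ≠ 0) (h1 : 1 + csq p ≠ 0) (hf : exp (I * p 0) ≠ 1) :
    ANc s 2 p = Gm s m 2 p := by
  set q := unshift m p with hqdef
  have hp0 := hp 0; have hp1 := hp 1; have hp2 := hp 2; have hp3 := hp 3
  have hq0 := hq 0; have hq1 := hq 1; have hq2 := hq 2; have hq3 := hq 3
  have hE0 := hE 0; have hE1 := hE 1; have hE2 := hE 2; have hE3 := hE 3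
  have hr := r0_ne_zero_Wt hW
  have hcs : (1 + csq p) ^ s ≠ 0 := pow_ne_zero _ h1
  have hl : ∀ j, lam m j p = q j / p j := fun j => lam_eq_div (hp j)
  unfold ANc Xc onePlusG Aprime X Gm num1
  simp only [Fin.isValue, fin_ne.2.1, ↓reduceIte]
  rw [scrD_unshift m p, l_unshift 2 m p, invSqBracket_unshift 0 m p, ← hqdef]
  rw [scrD_eq_Wt hW hq hcq, l_two, prefactor_eq hp hf, invSqBracket_eq_Wt hW hq hcq 0,
    invSqBracket_eq_Wt hW hq hcq 1, invSqBracket_eq_Wt hW hq hcq 3]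
  simp only [Fin.prod_univ_four, hl]
  unfold Eo
  field_simp

/-- **`Â₄ = Gm s m 3`** (print's `i = 4`) on the `m`-th cell at its generic points. [cite: FederbushWilliamson1987PhaseCellII,
(3.1), (5.1) p. 1417, (5.3), (5.6) p. 1418] -/
theorem ANc_eq_Gm_three (s : ℕ) (m : Idx) {p : Momentum} (hW : unshift m p ∈ Wt) (hq : ∀ i, unshift m p i ≠ 0)
    (hcq : csq (unshift m p) ≠ 0) (hE : ∀ j, E j (unshift m p) ≠ 0) (hg : 1 + ghat (unshift m p) ≠ 0)
    (hp : ∀ i, p i ≠ 0) (hc : csq p ≠ 0) (h1 : 1 + csq p ≠ 0) (hf : exp (I * p 0) ≠ 1) :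
    ANc s 3 p = Gm s m 3 p := by
  set q := unshift m p with hqdef
  have hp0 := hp 0; have hp1 := hp 1; have hp2 := hp 2; have hp3 := hp 3
  have hq0 := hq 0; have hq1 := hq 1; have hq2 := hq 2; have hq3 := hq 3
  have hE0 := hE 0; have hE1 := hE 1; have hE2 := hE 2; have hE3 := hE 3
  have hr := r0_ne_zero_Wt hW
  have hcs : (1 + csq p) ^ s ≠ 0 := pow_ne_zero _ h1
  have hl : ∀ j, lam m j p = q j / p j := fun j => lam_eq_div (hp j)
  unfold ANc Xc onePlusG Aprime X Gm num1
  simp only [Fin.isValue, fin_ne.2.2, ↓reduceIte]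
  rw [scrD_unshift m p, l_unshift 3 m p, invSqBracket_unshift 0 m p, ← hqdef]
  rw [scrD_eq_Wt hW hq hcq, l_three, prefactor_eq hp hf, invSqBracket_eq_Wt hW hq hcq 0,
    invSqBracket_eq_Wt hW hq hcq 1, invSqBracket_eq_Wt hW hq hcq 2]
  simp only [Fin.prod_univ_four, hl]
  unfold Eo
  field_simp

/-- **`Â_i = Gm s m i` for all four components** on the `m`-th cell at its generic points.
[cite: FederbushWilliamson1987PhaseCellII, (3.1), (5.1) p. 1417, (5.3)–(5.6) p. 1418] -/
theorem ANc_eq_Gm (s : ℕ) (m : Idx) {p : Momentum} (hW : unshift m p ∈ Wt) (hq : ∀ i, unshift m p i ≠ 0)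
    (hcq : csq (unshift m p) ≠ 0) (hE : ∀ j, E j (unshift m p) ≠ 0) (hg : 1 + ghat (unshift m p) ≠ 0)
    (hp : ∀ i, p i ≠ 0) (hc : csq p ≠ 0) (h1 : 1 + csq p ≠ 0) (hf : exp (I * p 0) ≠ 1) (i : Fin 4) :
    ANc s i p = Gm s m i p := by
  fin_cases i
  · exact ANc_eq_Gm_zero s m hW hq hcq hE hg hp hc h1 hf
  · exact ANc_eq_Gm_one s m hW hq hcq hE hg hp hc h1 hf
  · exact ANc_eq_Gm_two s m hW hq hcq hE hg hp hc h1 hf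
  · exact ANc_eq_Gm_three s m hW hq hcq hE hg hp hc h1 hf

end ModeAnalyticityCorrectedGauge

end Literature.MathematicalPhysics.QuantumFieldTheory.Federbush1986
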